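import Literature.Computability.QuantumComplexity.PhaseQueryAccept
import Literature.Computability.QuantumComplexity.PhaseQueryUniform
import Literature.Computability.QuantumComplexity.ForrelationCompleteProofs
import HarnessLib

/-!
# Phase-query families, VI: membership in `PromiseBQP` and the Forrelation amplitude

Last generic file of the construction (`PhaseQueryOps/Layout/State/Accept/Uniform.lean`):

* `mem_PromiseBQP_of_spec`: a promise problem whose yes-instances have
  `1 − (1 − |⟨0|phiFin⟩|²)³ ≥ 2/3` and whose no-instances have `≤ 1/3` is in `PromiseBQP` — the family
  is oracle-free (`family_isOracleFree`), uniform (`family_isUniform`) and has exactly this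
  acceptance probability (`acceptProbOn_family`);
* **the amplitude is a `k`-fold forrelation** (`phiFin_zero_eq_kForrelationValue`): if the
  specification answers `Kv x = k + 1` active Hadamard layers, `Wv x = W` active wires, and phase bits
  `Pf x u j = [j ≤ k] · g j (u restricted to the active wires)`, then the final block state is the
  Forrelation circuit `H^{⊗W} U_{g_k} H^{⊗W} ⋯ U_{g_1} H^{⊗W}` of Aaronson–Ambainis (§3.2, Fig. 2;
  `forrelationCircuit` of `ForrelationCompleteProofs.lean`) placed on the active wires and applied to
  `|0^{Wq}⟩`, so that `⟨0^{Wq}|phiFin⟩ = Φ_{g_1,…,g_k}` (`forrelationCircuit_apply_zero_zero`);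
* the threshold arithmetic (`accept_ge_of_amplitude`, `accept_le_of_amplitude`): `|Φ| ≥ 3/5` gives
  acceptance `≥ 2/3`, `|Φ| ≤ 1/16` gives acceptance `≤ 1/3` (Aaronson–Ambainis §6, p. 26: the gap
  `Φ² ≥ 0.36` versus `Φ² ≤ 10⁻⁴`, here OR-amplified over three runs).

## References

* S. Aaronson, A. Ambainis, *Forrelation*, SIAM J. Comput. 47 (2018), §3.2 (Fig. 2, Prop. 6), §6
  (p. 26) [AaronsonAmbainis2018].
* M. A. Nielsen, I. L. Chuang, *Quantum Computation and Quantum Information*, CUP 2010, §4.3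
  [NielsenChuang2010].
-/

noncomputable section

namespace Literature.Computability.QuantumComplexity

open _root_.Computability Complexity Cryptography Matrix Finset RevSim RevClean RazTalMachine Turing

namespace PhaseQuery

variable (P : Params) (S : Spec P)

/-! ### Membership in `PromiseBQP` -/

section Membership

/-- **A promise problem decided by the phase-query family is in `PromiseBQP`.**
[cite: AaronsonAmbainis2018, §6 (p. 26: explicit k-fold Forrelation is in PromiseBQP)] -/
theorem mem_PromiseBQP_of_spec (Q : PromiseProblem)
    (hyes : ∀ x ∈ Q.yes, (2 : ℝ) / 3 ≤ 1 - (1 - ‖phiFin P S x 0 fun _ => false‖ ^ 2) ^ 3)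
    (hno : ∀ x ∈ Q.no, 1 - (1 - ‖phiFin P S x 0 fun _ => false‖ ^ 2) ^ 3 ≤ (1 : ℝ) / 3) :
    Q ∈ PromiseBQP := by
  refine ⟨family P, family_isOracleFree P, family_isUniform P, fun x hx => ?_, fun x hx => ?_⟩
  · rw [acceptProbOn_family P S x 0]; exact hyes x hx
  · rw [acceptProbOn_family P S x 0]; exact hno x hx

/-- The acceptance probability as a function of the return amplitude is monotone in `|Φ|`:
`|Φ| ≥ 3/5` gives `1 − (1 − Φ²)³ ≥ 2/3`. [cite: AaronsonAmbainis2018, §6 (p. 26)] -/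
theorem accept_ge_of_amplitude {a : ℝ} (ha : (3 : ℝ) / 5 ≤ a) (ha1 : a ≤ 1) : (2 : ℝ) / 3 ≤ 1 - (1 - a ^ 2) ^ 3 := by
  have h0 : 0 ≤ 1 - a ^ 2 := by nlinarith
  have h1 : 1 - a ^ 2 ≤ 16 / 25 := by nlinarith
  have h2 : (1 - a ^ 2) ^ 3 ≤ (16 / 25 : ℝ) ^ 3 := pow_le_pow_left₀ h0 h1 3
  norm_num at h2
  linarith

/-- `|Φ| ≤ 1/16` gives `1 − (1 − Φ²)³ ≤ 1/3`. [cite: AaronsonAmbainis2018, §6 (p. 26)] -/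
theorem accept_le_of_amplitude {a : ℝ} (ha : a ≤ (1 : ℝ) / 16) (ha0 : 0 ≤ a) : 1 - (1 - a ^ 2) ^ 3 ≤ (1 : ℝ) / 3 := by
  have h1 : (255 / 256 : ℝ) ≤ 1 - a ^ 2 := by nlinarith
  have h2 : (255 / 256 : ℝ) ^ 3 ≤ (1 - a ^ 2) ^ 3 := pow_le_pow_left₀ (by norm_num) h1 3
  norm_num at h2
  linarith

end Membership

/-! ### The amplitude is a `k`-fold forrelation -/

section Amplitude

variable {W : ℕ}

/-- Selecting, among all wires, those below `W` picks the embedded initial segment. [folklore] -/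
theorem flatMap_finRange_ite_lt {α : Type*} : ∀ (n : ℕ) (hW : W ≤ n) (f : Fin n → α),
    ((List.finRange n).flatMap fun t => if t.val < W then [f t] else []) =
      (List.finRange W).map fun j => f (Fin.castLE hW j)
  | 0, hW, f => by
    have : W = 0 := by omega
    subst this; rfl
  | n + 1, hW, f => by
    rcases Nat.lt_or_ge n W with h | h
    · have : W = n + 1 := by omega
      subst this
      rw [List.map_eq_flatMap]
      refine List.flatMap_congr fun t _ => ?_
      rw [if_pos t.isLt]
      rfl
    · rw [List.finRange_succ_last, List.flatMap_append, List.flatMap_singleton, if_neg (by simp; omega), List.append_nil,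
        List.flatMap_map]
      exact flatMap_finRange_ite_lt n h (f ∘ Fin.castSucc)

variable (x : List Bool) (A : Language Bool)

local notation "N" => x.length

variable {k : ℕ}

/-- **The active Hadamard layers are `H^{⊗W}` on the active wires.** [cite: NielsenChuang2010, §1.4.4] -/
theorem Hm_eq_placeGate (hW : W ≤ Wq P N) {j : ℕ} (hKv : S.Kv x = k + 1) (hWv : S.Wv x = W) (hj : j < k + 1) :
    Hm P S x A j = placeGate (Fin.castLEEmb hW) (hGateAll W) := by
  rw [Hm, hSel, ← toMatrix_hLayerE A (Fin.castLEEmb hW), hLayerE]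
  congr 2
  simp only [Fin.castLEEmb_apply]
  rw [← flatMap_finRange_ite_lt _ hW hOn]
  refine List.flatMap_congr fun t _ => ?_
  rw [hKv, hWv]
  by_cases ht : t.val < W
  · rw [if_pos ⟨hj, ht⟩, if_pos ht]
  · rw [if_neg (fun h => ht h.2), if_neg ht]

/-- The inactive Hadamard layers are the identity. [folklore] -/
theorem Hm_eq_one {j : ℕ} (hKv : S.Kv x = k + 1) (hj : k + 1 ≤ j) : Hm P S x A j = 1 := by
  rw [Hm, hSel]
  have : ((List.finRange (Wq P N)).flatMap fun t => if j < S.Kv x ∧ t.val < S.Wv x then [hOn t] else []) = [] := by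
    rw [List.flatMap_eq_nil_iff]
    intro t _
    rw [if_neg (fun h => by omega)]
  rw [this, QCircuit.toMatrix_nil]

/-- **The phase layers are the phase gates of the predicates on the active wires.**
[cite: AaronsonAmbainis2018, §3.2 (Fig. 2)] -/
theorem Dg_eq_placeGate (hW : W ≤ Wq P N) (g : ℕ → (Fin W → Bool) → Bool)
    (hPf : ∀ (y : QReg (Wq P N)) (j : ℕ), 1 ≤ j → j ≤ Ly P N →
      S.Pf x (List.ofFn y) j = (decide (j ≤ k) && g j (y ∘ Fin.castLE hW)))
    {j : ℕ} (hj1 : 1 ≤ j) (hj : j ≤ Ly P N) :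
    Dg P S x j = placeGate (Fin.castLEEmb hW) (phaseLayer fun v => decide (j ≤ k) && g j v) := by
  rw [Dg, phaseLayer, placeGate_diagonal]
  congr 1
  funext y
  rw [sgnP, hPf y j hj1 hj]
  simp only [Fin.coe_castLEEmb]
  unfold signOf
  split_ifs <;> push_cast <;> rfl

variable (g : ℕ → (Fin W → Bool) → Bool)

/-- The Forrelation circuit without its last Hadamard layer: `Gc 0 = 1`,
`Gc (j+1) = U_{g_{j+1}} H^{⊗W} Gc j`. [cite: AaronsonAmbainis2018, §3.2 (Fig. 2)] -/
def Gc : ℕ → Matrix (QReg W) (QReg W) ℂ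
  | 0 => 1
  | j + 1 => phaseLayer (g (j + 1)) * hGateAll W * Gc j

/-- `forrelationCircuit k (g₁,…,g_k) = H^{⊗W} · Gc k`. [cite: AaronsonAmbainis2018, §3.2 (Fig. 2)] -/
theorem forrelationCircuit_eq_mul_Gc : ∀ j : ℕ,
    forrelationCircuit j (fun i : Fin j => g (i.val + 1)) = hGateAll W * Gc g j
  | 0 => by simp [forrelationCircuit, Gc]
  | j + 1 => by
    have hinit : (Fin.init fun i : Fin (j + 1) => g (i.val + 1)) = fun i : Fin j => g (i.val + 1) := by
      funext i; simp [Fin.init]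
    rw [forrelationCircuit, hinit, Fin.val_last, forrelationCircuit_eq_mul_Gc j, Gc]
    simp only [Matrix.mul_assoc]

/-- **The block states are the partial Forrelation circuits placed on the active wires.**
[cite: AaronsonAmbainis2018, §3.2 (Fig. 2)] -/
theorem phi_eq (hW : W ≤ Wq P N) (hk : k ≤ Ly P N) (hKv : S.Kv x = k + 1) (hWv : S.Wv x = W)
    (hPf : ∀ (y : QReg (Wq P N)) (j : ℕ), 1 ≤ j → j ≤ Ly P N →
      S.Pf x (List.ofFn y) j = (decide (j ≤ k) && g j (y ∘ Fin.castLE hW))) :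
    ∀ j : ℕ, j ≤ k → phi P S x A j = placeGate (Fin.castLEEmb hW) (Gc g j) *ᵥ basisState fun _ => false
  | 0, _ => by simp [phi, Gc, placeGate_one]
  | j + 1, hj => by
    rw [phi, phi_eq hW hk hKv hWv hPf j (by omega), Hm_eq_placeGate P S x A hW hKv hWv (by omega),
      Dg_eq_placeGate P S x hW g hPf (by omega) (by omega), Matrix.mulVec_mulVec, Matrix.mulVec_mulVec,
      ← placeGate_mul_holds, ← placeGate_mul_holds, Gc, decide_eq_true (by omega : j + 1 ≤ k)]
    simp only [Bool.true_and]

/-- Beyond layer `k` nothing happens. [folklore] -/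
theorem phi_eq_of_lt (hW : W ≤ Wq P N) (hk : k ≤ Ly P N) (hKv : S.Kv x = k + 1) (hWv : S.Wv x = W)
    (hPf : ∀ (y : QReg (Wq P N)) (j : ℕ), 1 ≤ j → j ≤ Ly P N →
      S.Pf x (List.ofFn y) j = (decide (j ≤ k) && g j (y ∘ Fin.castLE hW))) :
    ∀ j : ℕ, k + 1 ≤ j → j ≤ Ly P N →
      phi P S x A j = placeGate (Fin.castLEEmb hW) (hGateAll W * Gc g k) *ᵥ basisState fun _ => false
  | 0, hj, _ => by omega
  | j + 1, hj, hjL => by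
    have hD : Dg P S x (j + 1) = 1 := by
      rw [Dg_eq_placeGate P S x hW g hPf (by omega) hjL, decide_eq_false (by omega : ¬ j + 1 ≤ k)]
      simp only [Bool.false_and]
      rw [show phaseLayer (fun _ : Fin W → Bool => false) = 1 by
        ext a b; simp [phaseLayer, signOf, Matrix.diagonal_apply, Matrix.one_apply], placeGate_one]
    rcases Nat.lt_or_ge j (k + 1) with hjk | hjk
    · -- `j = k`: the last active Hadamard layer
      have hjk' : j = k := by omega
      subst hjk'
      rw [phi, hD, Matrix.one_mulVec, Hm_eq_placeGate P S x A hW hKv hWv (Nat.lt_succ_self _),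
        phi_eq P S x A g hW hk hKv hWv hPf j le_rfl, Matrix.mulVec_mulVec, ← placeGate_mul_holds]
    · rw [phi, hD, Matrix.one_mulVec, Hm_eq_one P S x A hKv hjk, Matrix.one_mulVec]
      exact phi_eq_of_lt hW hk hKv hWv hPf j hjk (by omega)

/-- **The final block state is the Forrelation circuit of the predicates, placed on the active
wires, applied to `|0…0⟩`.** [cite: AaronsonAmbainis2018, §3.2 (Fig. 2)] -/
theorem phiFin_eq (hW : W ≤ Wq P N) (hk : k ≤ Ly P N) (hKv : S.Kv x = k + 1) (hWv : S.Wv x = W)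
    (hPf : ∀ (y : QReg (Wq P N)) (j : ℕ), 1 ≤ j → j ≤ Ly P N →
      S.Pf x (List.ofFn y) j = (decide (j ≤ k) && g j (y ∘ Fin.castLE hW))) :
    phiFin P S x A = placeGate (Fin.castLEEmb hW) (forrelationCircuit k fun i : Fin k => g (i.val + 1)) *ᵥ
      basisState fun _ => false := by
  rw [forrelationCircuit_eq_mul_Gc, phiFin]
  rcases Nat.lt_or_ge (Ly P N) (k + 1) with h | h
  · have hkL : Ly P N = k := by omega
    rw [hkL, Hm_eq_placeGate P S x A hW hKv hWv (Nat.lt_succ_self _), phi_eq P S x A g hW hk hKv hWv hPf k le_rfl,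
      Matrix.mulVec_mulVec, ← placeGate_mul_holds]
  · rw [Hm_eq_one P S x A hKv h, Matrix.one_mulVec, phi_eq_of_lt P S x A g hW hk hKv hWv hPf (Ly P N) h le_rfl]

/-- **The return amplitude is the `k`-fold forrelation of the predicates** `g₁, …, g_k` on the
active wires. [cite: AaronsonAmbainis2018, §3.2 (Fig. 2) and Prop. 6] -/
theorem phiFin_zero_eq_kForrelationValue (hW : W ≤ Wq P N) (hk : k ≤ Ly P N) (hKv : S.Kv x = k + 1) (hWv : S.Wv x = W)
    (hPf : ∀ (y : QReg (Wq P N)) (j : ℕ), 1 ≤ j → j ≤ Ly P N →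
      S.Pf x (List.ofFn y) j = (decide (j ≤ k) && g j (y ∘ Fin.castLE hW))) :
    phiFin P S x A (fun _ => false) = (kForrelationValue (fun i : Fin k => g (i.val + 1)) : ℂ) := by
  rw [phiFin_eq P S x A g hW hk hKv hWv hPf, mulVec_basisState]
  dsimp only
  rw [placeGate_apply, if_pos (fun _ _ => rfl)]
  exact forrelationCircuit_apply_zero_zero _

end Amplitude

end PhaseQuery

end Literature.Computability.QuantumComplexity
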